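import Summits.CriticalPhenomena.Ising3D.TaylorTableEvenHead
import Summits.CriticalPhenomena.Ising3D.TaylorTableOddHead
import Summits.CriticalPhenomena.Ising3D.TaylorConeEvenCells
import Summits.CriticalPhenomena.Ising3D.TaylorConeOddCells
import Mathlib.Tactic.Linarith
import Mathlib.Tactic.Positivity
import Mathlib.Tactic.Ring
import HarnessLib

/-!
# The TABLE layer of a derivative certificate, V: the rational table (data, decidable checks, named hypotheses)
(cell `pub-ising3x`, seat boot-1 gen 6; gate (g2) of the M3-γ milestone — the data of the TABLE THEOREM;
the theorem itself is `TaylorTable.boxExcluded_of_taylorTable` in `TaylorTableTheorem.lean`)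

HONEST FRAMING: lottery ticket; floor = tightest certified 3D Ising CFT bounds; no exact-solution
claim without a proof. Island framing: certified exclusion region at stated derivative order and
assumptions; not a determination of the 3D Ising critical exponents beyond that.

A kind-`deriv` certificate for a rational box `Q = [σlo,σhi] × [εlo,εhi]` is the RATIONAL DATA
`T : TaylorTable` — weights `c` of `α = taylorCrossing ½ ½ L c` and `ψ` of the majorant `Ψ`, `κ₀`, thresholds
`E₀` (even) and `E_T` (odd), enclosure data for the three powers of `½`, the identity kd-certificate, and the
lists of even / odd head cells (spin, `Δ`-interval, head list, coefficient enclosures, kd-certificates). Its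
DECIDABLE part is the Boolean `T.check` (index hygiene, box admissibility, power enclosures, canonical head sets,
cell covers by consecutive chains, and every kd-tree check of layers II–IV); what is NOT decided by the kernel
here is named as three hypotheses with their exact mathematical content:
`T.Enclosures` (the coefficient intervals of the head cells enclose `hrCoeff`/`hrCoeffAB` over the cells —
discharged by the Literature coefficient tables or a reader), `T.EvenRegion` (the polynomial even cone region
`X̂, Ŷ ≥ 0, Ẑ² ≤ 4X̂Ŷ` for `E ≥ E₀`, integer `j ≤ E` — `taylorEvenRegion_half_of_qRegion`) and `T.OddCone` (the odd
cone `OddConeAt` for `E ≥ E_T`) — the two REGION layers (box partition of a compactified cone + leading forms,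
or the kernel route) are the remaining table files. THEOREM `boxExcluded_of_taylorTable`:
`T.check = true → T.Enclosures → T.EvenRegion → T.OddCone → BoxExcluded Q`
(via `TaylorConeObligations.of_oddCover`, `evenCellField_of_cover`, the per-cell theorems
`identity_pos_of_kdCheck`, `evenHead_nonneg_of_kdCheck`, `oddHead_nonneg_of_kdCheck`, and
`boxExcluded_of_taylorConeObligations_half`). Sources: Kos–Poland–Simmons-Duffin 2014 §3.3; Moore 1966 (interval
arithmetic). Elementary given the tree.
-/

namespace Summit.CriticalPhenomena.Ising3D

open Finset Set
open Literature.MathematicalPhysics.QuantumFieldTheory.ConformalBootstrap3D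
open Literature.Analysis.ValidatedNumerics

/-! ### Decidable bookkeeping: chains of cells and canonical head sets -/

/-- A list of rational intervals covers `[a, b]` by a consecutive chain: the first starts at or before `a`,
and either reaches `b` or hands over to the rest from its right end. [folklore] -/
def chainCovers : ℚ → ℚ → List (ℚ × ℚ) → Bool
  | _, _, [] => false
  | a, b, (u, v) :: rest => decide (u ≤ a) && (decide (b ≤ v) || chainCovers v b rest)

/-- **Soundness of `chainCovers`**: every real point of `[a, b]` lies in a listed interval. [folklore] -/
theorem chainCovers_sound : ∀ (a b : ℚ) (l : List (ℚ × ℚ)), chainCovers a b l = true →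
    ∀ x : ℝ, (a : ℝ) ≤ x → x ≤ (b : ℝ) → ∃ I ∈ l, ((I.1 : ℚ) : ℝ) ≤ x ∧ x ≤ ((I.2 : ℚ) : ℝ)
  | a, b, [], h, _, _, _ => by simp [chainCovers] at h
  | a, b, (u, v) :: rest, h, x, hax, hxb => by
    simp only [chainCovers, Bool.and_eq_true, Bool.or_eq_true, decide_eq_true_eq] at h
    obtain ⟨hu, h2⟩ := h
    have hu' : ((u : ℚ) : ℝ) ≤ x := le_trans (by exact_mod_cast hu) hax
    by_cases hx : x ≤ ((v : ℚ) : ℝ)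
    · exact ⟨(u, v), by simp, hu', hx⟩
    · rw [not_le] at hx
      rcases h2 with hb | hrest
      · exact ⟨(u, v), by simp, hu', hxb.trans (by exact_mod_cast hb)⟩
      · obtain ⟨I, hI, h1, h2⟩ := chainCovers_sound v b rest hrest x hx.le hxb
        exact ⟨I, List.mem_cons_of_mem _ hI, h1, h2⟩

/-- The canonical head-set condition, decidably: every descendant index `(n, j)` of spin `ℓ` with
`n < E - lo` is listed in `F`. [folklore] -/
def canonOK (ℓ : ℕ) (lo E : ℚ) (F : List (ℕ × ℕ)) : Bool :=
  (List.range (⌈E - lo⌉₊ + 1)).all fun n => (List.range (ℓ + n + 1)).all fun j =>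
    !decide (InDescendantRange ℓ n j) || !decide ((n : ℚ) < E - lo) || decide ((n, j) ∈ F)

/-- **Soundness of `canonOK`**: off `F`, a descendant term has `E ≤ lo + n`. [folklore] -/
theorem offHead_of_canonOK {ℓ : ℕ} {lo E : ℚ} {F : List (ℕ × ℕ)} (h : canonOK ℓ lo E F = true) :
    ∀ q : ℕ × ℕ, q ∉ F.toFinset → InDescendantRange ℓ q.1 q.2 → ((E : ℚ) : ℝ) ≤ (lo : ℝ) + (q.1 : ℝ) := by
  refine headSet_offCone (ℓ := ℓ) (a := (lo : ℝ)) (E_T := ((E : ℚ) : ℝ)) fun q hq hn => ?_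
  rw [List.mem_toFinset]
  simp only [canonOK, List.all_eq_true, List.mem_range, Bool.or_eq_true, Bool.not_eq_true',
    decide_eq_false_iff_not, decide_eq_true_eq] at h
  have hnQ : (q.1 : ℚ) < E - lo := by
    have : (q.1 : ℝ) < ((E - lo : ℚ) : ℝ) := by push_cast; linarith
    exact_mod_cast this
  have hn1 : q.1 < ⌈E - lo⌉₊ + 1 := by
    have : (q.1 : ℚ) ≤ ⌈E - lo⌉₊ := hnQ.le.trans (Nat.le_ceil _)
    exact_mod_cast Nat.lt_succ_of_le (by exact_mod_cast this)
  have hj : q.2 < ℓ + q.1 + 1 := Nat.lt_succ_of_le hq.2.1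
  rcases h q.1 hn1 q.2 hj with h1 | h2
  · rcases h1 with h1 | h1
    · exact absurd hq h1
    · exact absurd hnQ h1
  · exact h2

/-! ### The table -/

/-- Enclosure data for a power `(½)^t`: exponent range `[r₁, r₂]` and value range `[lo, hi]`. [folklore] -/
structure PowEncl where
  /-- lower bound of the exponent -/
  r₁ : ℚ
  /-- upper bound of the exponent -/
  r₂ : ℚ
  /-- lower bound of the value -/
  lo : ℚ
  /-- upper bound of the value -/
  hi : ℚ

/-- The decidable checks of a power enclosure against the exponent bounds `t₁ ≤ t ≤ t₂`. [folklore] -/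
def PowEncl.check (P : PowEncl) (t₁ t₂ : ℚ) : Bool :=
  decide (0 < P.hi) && decide (P.r₁ ≤ t₁) && decide (t₂ ≤ P.r₂) &&
    decide (P.lo ^ P.r₂.den ≤ (1 / 2 : ℚ) ^ (P.r₂.num : ℤ)) && decide ((1 / 2 : ℚ) ^ (P.r₁.num : ℤ) ≤ P.hi ^ P.r₁.den)

/-- An even head cell of the table. [folklore] -/
structure EvenCellData where
  /-- even spin -/
  ℓ : ℕ
  /-- left end of the `Δ`-cell -/
  lo : ℚ
  /-- right end of the `Δ`-cell -/
  hi : ℚ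
  /-- head list -/
  F : List (ℕ × ℕ)
  /-- enclosures of `A_{n,j}(Δ,ℓ)/λ_ℓ` on the cell, aligned with `F` -/
  A : List (ℚ × ℚ)
  /-- kd-certificates for `X̃ ≥ 0`, `Ỹ ≥ 0`, `4X̃Ỹ - Z̃² ≥ 0` -/
  tX : KdCert ℕ
  /-- see `tX` -/
  tY : KdCert ℕ
  /-- see `tX` -/
  tD : KdCert ℕ

/-- An odd head cell of the table. [folklore] -/
structure OddCellData where
  /-- spin -/
  ℓ : ℕ
  /-- left end of the `Δ`-cell -/
  lo : ℚ
  /-- right end of the `Δ`-cell -/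
  hi : ℚ
  /-- head list -/
  F : List (ℕ × ℕ)
  /-- enclosures of `(cₛ, c₊, c₋)` on box × cell, aligned with `F` -/
  A : List ((ℚ × ℚ) × (ℚ × ℚ) × (ℚ × ℚ))
  /-- kd-certificate for the bracket sum -/
  t : KdCert ℕ

/-- **The rational table of a kind-`deriv` certificate** (module docstring). [folklore] -/
structure TaylorTable where
  /-- weights of the crossing functional, components `0..4` -/
  c : Fin 5 → ℕ × ℕ → ℚ
  /-- Taylor index list of the functional -/
  L : List (ℕ × ℕ)
  /-- weights of the majorant functional `Ψ` -/
  ψ : ℕ × ℕ → ℚ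
  /-- Taylor index list of `Ψ` -/
  Lψ : List (ℕ × ℕ)
  /-- the cone weight `κ₀ > 0` -/
  κ₀ : ℚ
  /-- the box -/
  σlo : ℚ
  /-- the box -/
  σhi : ℚ
  /-- the box -/
  εlo : ℚ
  /-- the box -/
  εhi : ℚ
  /-- even head threshold -/
  E₀ : ℚ
  /-- odd head threshold -/
  E_T : ℚ
  /-- even spin cut-off (`E₀ ≤ LE + 1`) -/
  LE : ℕ
  /-- odd spin cut-off (`E_T ≤ LT + 1`) -/
  LT : ℕ
  /-- enclosure of `(½)^{Δε-Δσ}` -/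
  κ : PowEncl
  /-- enclosure of `(½)^{-2Δσ}` -/
  μσ : PowEncl
  /-- enclosure of `(½)^{-2Δε}` -/
  με : PowEncl
  /-- identity kd-certificate and its (negative) bound -/
  tI : KdCert ℕ
  /-- see `tI` -/
  bI : ℚ
  /-- even head cells -/
  evenCells : List EvenCellData
  /-- odd head cells -/
  oddCells : List OddCellData

namespace TaylorTable

variable (T : TaylorTable)

/-- The box `Q`. [folklore] -/
def box : Set (ℝ × ℝ) := Icc (T.σlo : ℝ) T.σhi ×ˢ Icc (T.εlo : ℝ) T.εhi

/-- The crossing functional. [folklore] -/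
noncomputable def α : CrossingFunctional :=
  taylorCrossing (1 / 2) (1 / 2) T.L.toFinset (fun k ab => (T.c k ab : ℝ))

/-- The majorant functional. [folklore] -/
noncomputable def Ψ : (ℝ → ℝ → ℝ) →ₗ[ℝ] ℝ :=
  ∑ ab ∈ T.Lψ.toFinset, (T.ψ ab : ℝ) • taylorCoeffAt (1 / 2) (1 / 2) ab

/-- Basic checks: index hygiene, box admissibility, thresholds, `κ₀ > 0`. [folklore] -/
def checkBasic : Bool :=
  decide T.L.Nodup && decide T.Lψ.Nodup && decide (0 < T.κ₀) && decide (1 / 2 < T.σlo) &&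
    decide (T.σhi < 1) && decide (T.σhi + 1 / 2 < T.εlo) && decide (1 / 2 < T.E₀) &&
    decide (T.E₀ ≤ (T.LE : ℚ) + 1) && decide (T.E_T ≤ (T.LT : ℚ) + 1)

/-- Power enclosures and the identity certificate. [folklore] -/
def checkIdentity : Bool :=
  T.κ.check (T.εlo - T.σhi) (T.εhi - T.σlo) && T.μσ.check (-(2 * T.σhi)) (-(2 * T.σlo)) &&
    T.με.check (-(2 * T.εhi)) (-(2 * T.εlo)) && decide (T.bI < 0) &&
    T.tI.check (exprLeOn (.neg (identityExpr T.c T.L)) T.bI) [(T.σlo, T.σhi), (T.εlo, T.εhi), (T.κ.lo, T.κ.hi)]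

/-- Per even cell: hygiene, canonical head set, three kd checks. [folklore] -/
def checkEvenCell (C : EvenCellData) : Bool :=
  decide C.F.Nodup && (C.F.all fun q => decide (q.2 ≤ C.ℓ + q.1)) && decide ((C.ℓ : ℚ) ≤ C.lo) &&
    decide (C.A.length = C.F.length) && canonOK C.ℓ C.lo T.E₀ C.F &&
    C.tX.check (exprLeOn (.neg (evenHeadXExpr T.c T.L C.F)) 0) (evenHeadBox T.σlo T.σhi T.εlo T.εhi C.lo C.hi C.A) &&
    C.tY.check (exprLeOn (.neg (evenHeadYExpr T.c T.L C.F)) 0) (evenHeadBox T.σlo T.σhi T.εlo T.εhi C.lo C.hi C.A) &&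
    C.tD.check (exprLeOn (.neg (evenHeadDetExpr T.c T.L C.F)) 0) (evenHeadBox T.σlo T.σhi T.εlo T.εhi C.lo C.hi C.A)

/-- The intervals of the listed cells of a given spin. [folklore] -/
def evenIvls (ℓ : ℕ) : List (ℚ × ℚ) := (T.evenCells.filter fun C => C.ℓ = ℓ).map fun C => (C.lo, C.hi)

/-- Even cover: an `ε`-row cell, a chain over `[3, E₀]` at spin `0`, chains over `[ℓ+1, E₀]` at even `2 ≤ ℓ < LE`.
[folklore] -/
def checkEvenCover : Bool :=
  (T.evenCells.any fun C => decide (C.ℓ = 0) && decide (C.lo ≤ T.εlo) && decide (T.εhi ≤ C.hi)) &&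
    chainCovers 3 T.E₀ (T.evenIvls 0) &&
    ((List.range T.LE).all fun ℓ => decide (ℓ = 0) || !decide (Even ℓ) || chainCovers ((ℓ : ℚ) + 1) T.E₀ (T.evenIvls ℓ))

/-- Per odd cell: hygiene, canonical head set, the kd check. [folklore] -/
def checkOddCell (C : OddCellData) : Bool :=
  decide C.F.Nodup && (C.F.all fun q => decide (q.2 ≤ C.ℓ + q.1)) && decide ((C.ℓ : ℚ) ≤ C.lo) &&
    decide (C.A.length = C.F.length) && canonOK C.ℓ C.lo T.E_T C.F &&
    C.t.check (exprLeOn (.neg (oddBracketSumExpr T.c T.L T.ψ T.Lψ T.κ₀ C.ℓ C.F)) 0)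
      (oddHeadBox T.σlo T.σhi T.εlo T.εhi C.lo C.hi T.κ.lo T.κ.hi T.μσ.lo T.μσ.hi T.με.lo T.με.hi C.A)

/-- The intervals of the listed odd cells of a given spin. [folklore] -/
def oddIvls (ℓ : ℕ) : List (ℚ × ℚ) := (T.oddCells.filter fun C => C.ℓ = ℓ).map fun C => (C.lo, C.hi)

/-- Odd cover: a `σ`-row cell, a chain over `[3, E_T]` at spin `0`, chains over `[ℓ+1, E_T]` at `1 ≤ ℓ < LT`.
[folklore] -/
def checkOddCover : Bool :=
  (T.oddCells.any fun C => decide (C.ℓ = 0) && decide (C.lo ≤ T.σlo) && decide (T.σhi ≤ C.hi)) &&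
    chainCovers 3 T.E_T (T.oddIvls 0) &&
    ((List.range T.LT).all fun ℓ => decide (ℓ = 0) || chainCovers ((ℓ : ℚ) + 1) T.E_T (T.oddIvls ℓ))

/-- **The decidable part of the table.** [folklore] -/
def check : Bool :=
  T.checkBasic && T.checkIdentity && T.evenCells.all T.checkEvenCell && T.checkEvenCover &&
    T.oddCells.all T.checkOddCell && T.checkOddCover

/-- HYPOTHESIS 1 (coefficient tables): the enclosures of the head cells are valid (the Hogervorst–Rychkov /
Dolan–Osborn coefficients of the certificate's head terms lie in the listed intervals over the cells).
[cite: KosPolandSimmonsduffin2014, §3.3 eq. (3.16)] -/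
def Enclosures : Prop :=
  (∀ C ∈ T.evenCells, ∀ Δ : ℝ, (C.lo : ℝ) ≤ Δ → Δ ≤ C.hi → ∀ (i : ℕ) (q : ℕ × ℕ) (I : ℚ × ℚ),
      C.F[i]? = some q → C.A[i]? = some I →
      (I.1 : ℝ) ≤ hrCoeff Δ C.ℓ q.1 q.2 / legendreLam C.ℓ ∧ hrCoeff Δ C.ℓ q.1 q.2 / legendreLam C.ℓ ≤ (I.2 : ℝ)) ∧
  (∀ C ∈ T.oddCells, ∀ p ∈ T.box, ∀ Δ : ℝ, (C.lo : ℝ) ≤ Δ → Δ ≤ C.hi →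
      ∀ (i : ℕ) (q : ℕ × ℕ) (I : (ℚ × ℚ) × (ℚ × ℚ) × (ℚ × ℚ)), C.F[i]? = some q → C.A[i]? = some I →
        ((I.1.1 : ℝ) ≤ (oddCoeffs p.1 p.2 Δ C.ℓ q).1 ∧ (oddCoeffs p.1 p.2 Δ C.ℓ q).1 ≤ (I.1.2 : ℝ)) ∧
        ((I.2.1.1 : ℝ) ≤ (oddCoeffs p.1 p.2 Δ C.ℓ q).2.1 ∧ (oddCoeffs p.1 p.2 Δ C.ℓ q).2.1 ≤ (I.2.1.2 : ℝ)) ∧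
        ((I.2.2.1 : ℝ) ≤ (oddCoeffs p.1 p.2 Δ C.ℓ q).2.2 ∧ (oddCoeffs p.1 p.2 Δ C.ℓ q).2.2 ≤ (I.2.2.2 : ℝ)))

/-- HYPOTHESIS 2 (even region layer): the polynomial even cone region from `E₀` on (the `hq` of
`taylorEvenRegion_half_of_qRegion`). [cite: KosPolandSimmonsduffin2014, §3.3 eq. (3.16)] -/
def EvenRegion : Prop :=
  ∀ p ∈ T.box, ∀ (E : ℝ) (j : ℕ), ((T.E₀ : ℚ) : ℝ) ≤ E → (j : ℝ) ≤ E →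
    0 ≤ qSum (fun ab => (T.c 0 ab : ℝ)) T.L.toFinset p.1 (-1) E j ∧
      0 ≤ qSum (fun ab => (T.c 1 ab : ℝ)) T.L.toFinset p.2 (-1) E j ∧
      (qSum (fun ab => (T.c 3 ab : ℝ)) T.L.toFinset ((p.1 + p.2) / 2) (-1) E j +
          qSum (fun ab => (T.c 4 ab : ℝ)) T.L.toFinset ((p.1 + p.2) / 2) 1 E j) ^ 2 ≤
        4 * qSum (fun ab => (T.c 0 ab : ℝ)) T.L.toFinset p.1 (-1) E j *
          qSum (fun ab => (T.c 1 ab : ℝ)) T.L.toFinset p.2 (-1) E j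

/-- HYPOTHESIS 3 (odd cone layer): `OddConeAt` from `E_T` on (the `odd_cone` field for the table's functional).
[cite: KosPolandSimmonsduffin2014, §3.3 eq. (3.16)] -/
def OddCone : Prop :=
  ∀ p ∈ T.box, ∀ (E : ℝ) (j : ℕ), ((T.E_T : ℚ) : ℝ) ≤ E → (j : ℝ) ≤ E → OddConeAt T.α T.Ψ T.κ₀ p.1 p.2 E j

end TaylorTable

end Summit.CriticalPhenomena.Ising3D
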